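import Summits.BirchSwinnertonDyer.BirchSwinnertonDyer.Theses.KatoDescentPotSupersingular
import Summits.BirchSwinnertonDyer.BirchSwinnertonDyer.Theorems.KatoDescentPotSupersingularWildUpperOptimalSharpNodesJ08
import HarnessLib

/-!
# Route `KatoDescentPotSupersingular` (rung K9, wild `3`, cell `bsd-potss`): CLOSER of the glue item
# `WildUpperNonsurjTowerOfOptimalSharpRoadJ08` (R146 K9 twin — the U₀-ns node `WildUpperNonsurjTower` re-threaded through the
# LANDED Literature reading `Jetchev2008.cor15_irreducibleReading_…` BY NAME, alias item `JetchevIrreducibleReadingByName`,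
# plus the displayed `q = 3` schema `WildJetchevBoundAtP`) — one line over this seat's kernel
# `WildUpperOptimalSharpNodesJ08.wildUpperNonsurjTower_of_jetchev08_of_boundAtP_of_cruxAResidue` (p496258); seat
# `bsd-potss-k8t-c4` g7 (courtesy K9). Glue only; the cruxes stay open; BSD is not proved by any of this.
-/

set_option autoImplicit false
-- the Theorems directory repeats the summit name (sibling precedent `KatoDescentPotSupersingularAssembly.lean`)
set_option linter.dupNamespace false

noncomputable section

namespace Summit.BirchSwinnertonDyer.BirchSwinnertonDyer.Theorems

open Summit.BirchSwinnertonDyer.BirchSwinnertonDyer.Theses.KatoDescentPotSupersingular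

/-- **Closer of the glue item `WildUpperNonsurjTowerOfOptimalSharpRoadJ08`** (type = the route decl BY NAME): the alias
`JetchevIrreducibleReadingByName` unfolds to the Literature fact, the held Heegner conjunction is destructured, and this
seat's node `WildUpperOptimalSharpNodesJ08.wildUpperNonsurjTower_of_jetchev08_of_boundAtP_of_cruxAResidue` applies.
Glue only; nothing about BSD is asserted. [cite: Jetchev2008, Thm. 1.4, Cor. 1.5 (p. 3), Rem. 6.2 (p. 15)]
[cite: MatarNekovar2019, Thm. 0.7, §0.11 (p. 457)] [cite: MilneADT2006, Thm. I.7.3] -/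
theorem wildUpperNonsurjTowerOfOptimalSharpRoadJ08_proof :
    Summit.BirchSwinnertonDyer.BirchSwinnertonDyer.Theses.KatoDescentPotSupersingular.WildUpperNonsurjTowerOfOptimalSharpRoadJ08 :=
  fun hJ hJp hH hC₄ hCS h₂ hR hK hF =>
    WildUpperOptimalSharpNodesJ08.wildUpperNonsurjTower_of_jetchev08_of_boundAtP_of_cruxAResidue
      hJ hJp hH.1 hH.2.1 hH.2.2.1 hH.2.2.2.1 hH.2.2.2.2 hC₄ hCS h₂ hR hK hF

end Summit.BirchSwinnertonDyer.BirchSwinnertonDyer.Theorems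

end
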